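import Summits.BirchSwinnertonDyer.BirchSwinnertonDyer.Theorems.ClassRecordThreeRegCertKernel
import HarnessLib

/-!
# Route `ClassRecordThree`, crux `SchneiderAtThree` (item 19106): the `y`-FREE form of a REG3CERT kernel certificate —
# the certificate point given by its `x`-coordinate alone (`∃ y` by `IsSquare`, the root pinned `3`-adically by Hensel)
# (cell `bsd-stepL`, seat `bsd-stepL-reg3-eng` g4; `--supports stmt-BirchSwinnertonDyer-19106`)

HONEST FRAMING: BSD is not proved by any of this; nothing here closes the crux; Schneider's non-degeneracy conjecture
(barrier `PAdicHeightNondegeneracy`) is asserted NOWHERE; every application is ONE curve. Purpose: the five REG3CERT rows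
whose certificate point `Q = m0 • P = (a/e², b/e³)` has `48 914 … 72 331`-digit `e` cannot be written with `b` (`≈ 3·digits(e)`
characters) under the proposal byte cap. The rung needs only SOME point of `W` carrying a certificate, and the height of `−Q`
equals that of `Q`; so the row may name `x = a/e²` alone:

* §1 `∃ b, b² + (a₁ae + a₃e³)b = a³ + a₂a²e² + a₄ae⁴ + a₆e⁶` from **`IsSquare ((a₁ae + a₃e³)² + 4(a³ + …))`** (decided by
  `norm_num`; the square root lives only in the proof term), with the root PINNED: `3^M ∣ b − β` for the residue `β` of the row
  (Hensel: `3^M ∣ β² + Pβ − R`, `3 ∤ 2β + P`; the other root is `−β − P`, and `(a/e², ·)` ranges over `±Q`);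
* §2 non-singular reduction at EVERY prime from `y`-free integers: `gcd((a₁ae + a₃e³)² + 4R, a₁e(a₁ae + a₃e³) + 2(3a² + 2a₂ae² + a₄e⁴)) ∣ (2e)ⁿ`
  plus a parity clause at `ℓ = 2` (`Φ_y·e³ = 2b + P` squares to the first integer; `2Φ_x·e⁴ ≡ −(second)` modulo any prime
  dividing `2b + P`);
* §3 `rung_of_exists_cert`: the rung of item 19106 from `∃ y, (x, y) ∈ W ∧ ∀ h, CertNonsplit W 3 (x, y) 1`.

The per-checker `y`-free wrappers (first order, second order, third order, uniform) live in `…RegCertKernelYFreeCert`.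
Theorems only (0 defs, 0 facts). References: [SilvermanAEC2009] III.1, VII.2.1, VII.3.4; [SteinWuthrich2013] §4.2;
[KolyvaginEulerSystems1990] Thm. A (GZK).
-/

open scoped Classical

open WeierstrassCurve Literature.NumberTheory.EllipticCurves
  Literature.NumberTheory.EllipticCurves.Rank1Residual
  Literature.NumberTheory.EllipticCurves.SteinWuthrich2013
  Summit.BirchSwinnertonDyer.Rank1Residual
  Summit.BirchSwinnertonDyer.Rank1Residual.X11b

namespace Summit.BirchSwinnertonDyer.Rank1Residual.X11b.RegMult.KernelCert

/-! ### §1 The `y`-coordinate from `IsSquare`, pinned `3`-adically -/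

/-- **An integral point above `x = a/e²` from a square discriminant, with its root pinned modulo `3^M`.** With
`P = a₁ae + a₃e³` and `R = a³ + a₂a²e² + a₄ae⁴ + a₆e⁶`: if `P² + 4R` is a square, `3^M ∣ β² + Pβ − R` and `3 ∤ 2β + P`,
then some integer `b` has `b² + Pb = R` (i.e. `(a/e², b/e³) ∈ W`) and `3^M ∣ b − β` (the two roots are `b` and `−b − P`;
exactly one is `≡ β`). [Silverman AEC III.1] [cite: SilvermanAEC2009, III.1] -/
theorem exists_root_dvd_sub_of_isSquare {P R β : ℤ} {M : ℕ} (hsq : IsSquare (P ^ 2 + 4 * R))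
    (hβ : (3 : ℤ) ^ M ∣ β ^ 2 + P * β - R) (h3 : ¬ (3 : ℤ) ∣ 2 * β + P) :
    ∃ b : ℤ, b ^ 2 + P * b = R ∧ (3 : ℤ) ^ M ∣ b - β := by
  obtain ⟨r, hr⟩ := hsq
  -- `r ≡ P (mod 2)`
  have heven : Even (r - P) := by
    have hprod : Even ((r - P) * (r + P)) := ⟨2 * R, by linear_combination -hr⟩
    rcases Int.even_mul.mp hprod with h | h
    · exact h
    · have : r - P = (r + P) - 2 * P := by ring
      rw [this]; exact h.sub (even_two_mul P)
  obtain ⟨b₀, hb₀⟩ := heven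
  have hroot : b₀ ^ 2 + P * b₀ = R := by
    have h4 : (4 : ℤ) * (b₀ ^ 2 + P * b₀ - R) = 0 := by linear_combination (-1 : ℤ) * hr - (2 * b₀ + P + r) * hb₀
    rcases mul_eq_zero.mp h4 with h | h
    · norm_num at h
    · linear_combination h
  -- the two roots `b₀`, `−b₀ − P`; their difference from `β` multiplies to `0 (mod 3^M)`
  have hprod : (3 : ℤ) ^ M ∣ (b₀ - β) * (b₀ + β + P) := by
    have : (b₀ - β) * (b₀ + β + P) = -(β ^ 2 + P * β - R) + (b₀ ^ 2 + P * b₀ - R) := by ring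
    rw [this, hroot, sub_self, add_zero]; exact hβ.neg_right
  have h3p : Prime (3 : ℤ) := Int.prime_three
  by_cases hcase : (3 : ℤ) ∣ b₀ - β
  · -- then `3 ∤ b₀ + β + P`, so `3^M ∣ b₀ − β`
    have hother : ¬ (3 : ℤ) ∣ b₀ + β + P := by
      intro h
      have : (3 : ℤ) ∣ (b₀ + β + P) - (b₀ - β) := dvd_sub h hcase
      rw [show (b₀ + β + P) - (b₀ - β) = 2 * β + P by ring] at this
      exact h3 this
    exact ⟨b₀, hroot, h3p.pow_dvd_of_dvd_mul_right M hother hprod⟩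
  · -- then `3^M ∣ b₀ + β + P`: take the other root `−b₀ − P`
    refine ⟨-b₀ - P, by linear_combination hroot, ?_⟩
    have h := h3p.pow_dvd_of_dvd_mul_left M hcase hprod
    rw [show -b₀ - P - β = -(b₀ + β + P) by ring]; exact h.neg_right

/-! ### §2 Non-singular reduction at every prime from `y`-free integers -/

section Point

variable (W : WeierstrassCurve ℚ) {a₁ a₂ a₃ a₄ a₆ : ℤ} (hW : W = ⟨a₁, a₂, a₃, a₄, a₆⟩)
  {a b : ℤ} {e : ℕ} (he : e ≠ 0) {x y : ℚ} (hx : x = a / (e : ℚ) ^ 2) (hy : y = b / (e : ℚ) ^ 3)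
include hW he hx hy

/-- From "at every prime `ℓ ∤ e`, `ℓ ∤ Φ_y·e³` or `ℓ ∤ Φ_x·e⁴`" to non-singular reduction at every prime (the `gcd`-free core
of `hasNonsingularReductionAt_of_gcd`). [Silverman AEC VII.2.1] [cite: SilvermanAEC2009, VII.2.1] -/
theorem hasNonsingularReductionAt_of_forall_not_dvd (hcop : Nat.Coprime a.natAbs e)
    (hAB : ∀ ℓ : ℕ, ℓ.Prime → ¬ ℓ ∣ e →
      ¬ (ℓ : ℤ) ∣ 2 * b + a₁ * a * e + a₃ * e ^ 3 ∨ ¬ (ℓ : ℤ) ∣ a₁ * b * e - (3 * a ^ 2 + 2 * a₂ * a * e ^ 2 + a₄ * e ^ 4))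
    (ℓ : ℕ) (hℓ : ℓ.Prime) : W.HasNonsingularReductionAt ℓ x y := by
  haveI : Fact ℓ.Prime := ⟨hℓ⟩
  by_cases hℓe : ℓ ∣ e
  · exact Or.inl (padicValRat_x_neg he hx hcop hℓe)
  · have he' : (e : ℚ) ≠ 0 := by exact_mod_cast he
    have hve : padicValRat ℓ (e : ℚ) = 0 := by
      rw [← padicValRat_of_nat, padicValNat.eq_zero_of_not_dvd hℓe]; rfl
    rcases hAB ℓ hℓ hℓe with hA | hB
    · have hA0 : ((2 * b + a₁ * a * e + a₃ * e ^ 3 : ℤ) : ℚ) ≠ 0 := by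
        have : (2 * b + a₁ * a * e + a₃ * e ^ 3 : ℤ) ≠ 0 := fun h => hA (h ▸ dvd_zero _)
        exact_mod_cast this
      refine Or.inr (Or.inr ⟨?_, ?_⟩)
      · rw [polynomialY_eq W hW he hx hy]; exact div_ne_zero hA0 (pow_ne_zero 3 he')
      · rw [polynomialY_eq W hW he hx hy, padicValRat.div hA0 (pow_ne_zero 3 he'), padicValRat.pow _, hve,
          padicValRat.of_int, padicValInt.eq_zero_of_not_dvd hA]
        simp
    · have hB0 : ((a₁ * b * e - (3 * a ^ 2 + 2 * a₂ * a * e ^ 2 + a₄ * e ^ 4) : ℤ) : ℚ) ≠ 0 := by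
        have : (a₁ * b * e - (3 * a ^ 2 + 2 * a₂ * a * e ^ 2 + a₄ * e ^ 4) : ℤ) ≠ 0 := fun h => hB (h ▸ dvd_zero _)
        exact_mod_cast this
      refine Or.inr (Or.inl ⟨?_, ?_⟩)
      · rw [polynomialX_eq W hW he hx hy]; exact div_ne_zero hB0 (pow_ne_zero 4 he')
      · rw [polynomialX_eq W hW he hx hy, padicValRat.div hB0 (pow_ne_zero 4 he'), padicValRat.pow _, hve,
          padicValRat.of_int, padicValInt.eq_zero_of_not_dvd hB]
        simp

end Point

/-- **The `y`-free reduction test.** For `b² + Pb = R` (`P = a₁ae + a₃e³`, `R = a³ + a₂a²e² + a₄ae⁴ + a₆e⁶`): at a prime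
`ℓ ∤ e`, if `ℓ` divided both `Φ_y·e³ = 2b + P` and `Φ_x·e⁴ = a₁be − S` (`S = 3a² + 2a₂ae² + a₄e⁴`) then, for `ℓ` odd, `ℓ` divides
`(2b + P)² = P² + 4R` and `a₁e(2b + P) − 2(a₁be − S) = a₁eP + 2S`; so `gcd(P² + 4R, a₁eP + 2S) ∣ (2e)ⁿ` excludes it. At `ℓ = 2 ∤ e`:
`2b + P` odd iff `P` odd, and if `P` is even then `b ≡ R (mod 2)`, so `a₁be − S ≡ a₁eR − S (mod 2)`. [cite: SilvermanAEC2009, VII.2.1] -/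
theorem forall_not_dvd_of_yfree {a₁ a₂ a₃ a₄ a₆ a b : ℤ} {e n : ℕ}
    (hb : b ^ 2 + (a₁ * a * e + a₃ * e ^ 3) * b = a ^ 3 + a₂ * a ^ 2 * e ^ 2 + a₄ * a * e ^ 4 + a₆ * e ^ 6)
    (hgcd : Int.gcd ((a₁ * a * e + a₃ * e ^ 3) ^ 2 + 4 * (a ^ 3 + a₂ * a ^ 2 * e ^ 2 + a₄ * a * e ^ 4 + a₆ * e ^ 6))
      (a₁ * e * (a₁ * a * e + a₃ * e ^ 3) + 2 * (3 * a ^ 2 + 2 * a₂ * a * e ^ 2 + a₄ * e ^ 4)) ∣ (2 * e) ^ n)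
    (h2 : ¬ (2 : ℤ) ∣ a₁ * a * e + a₃ * e ^ 3 ∨
      ¬ (2 : ℤ) ∣ a₁ * e * (a ^ 3 + a₂ * a ^ 2 * e ^ 2 + a₄ * a * e ^ 4 + a₆ * e ^ 6) - (3 * a ^ 2 + 2 * a₂ * a * e ^ 2 + a₄ * e ^ 4))
    (ℓ : ℕ) (hℓ : ℓ.Prime) (hℓe : ¬ ℓ ∣ e) :
    ¬ (ℓ : ℤ) ∣ 2 * b + a₁ * a * e + a₃ * e ^ 3 ∨ ¬ (ℓ : ℤ) ∣ a₁ * b * e - (3 * a ^ 2 + 2 * a₂ * a * e ^ 2 + a₄ * e ^ 4) := by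
  set P : ℤ := a₁ * a * e + a₃ * e ^ 3 with hP
  set R : ℤ := a ^ 3 + a₂ * a ^ 2 * e ^ 2 + a₄ * a * e ^ 4 + a₆ * e ^ 6 with hR
  set S : ℤ := 3 * a ^ 2 + 2 * a₂ * a * e ^ 2 + a₄ * e ^ 4 with hS
  have hA : 2 * b + a₁ * a * e + a₃ * e ^ 3 = 2 * b + P := by rw [hP]; ring
  rw [hA]
  by_contra hcon
  have hAℓ : (ℓ : ℤ) ∣ 2 * b + P := by by_contra h'; exact hcon (Or.inl h')
  have hBℓ : (ℓ : ℤ) ∣ a₁ * b * e - (3 * a ^ 2 + 2 * a₂ * a * e ^ 2 + a₄ * e ^ 4) := by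
    by_contra h'; exact hcon (Or.inr h')
  by_cases hℓ2 : ℓ = 2
  · subst hℓ2
    push_cast at hAℓ hBℓ
    have h2P : (2 : ℤ) ∣ P := by
      have : P = (2 * b + P) - 2 * b := by ring
      rw [this]; exact dvd_sub hAℓ (dvd_mul_right 2 b)
    rcases h2 with h | h
    · exact h h2P
    · -- `P` even ⇒ `b ≡ R (mod 2)` ⇒ `a₁be − S ≡ a₁eR − S (mod 2)`
      apply h
      have key : ∀ (p r s t u : ZMod 2), p = 0 → u ^ 2 + p * u = r → t * u - s = 0 → t * r - s = 0 := by decide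
      have hcast := key (P : ZMod 2) (R : ZMod 2) (S : ZMod 2) ((a₁ * e : ℤ) : ZMod 2) (b : ZMod 2)
        (by rw [ZMod.intCast_zmod_eq_zero_iff_dvd]; exact_mod_cast h2P)
        (by exact_mod_cast congrArg (fun z : ℤ => (z : ZMod 2)) hb)
        (by
          have := (ZMod.intCast_zmod_eq_zero_iff_dvd (a₁ * b * e - S) 2).mpr (by exact_mod_cast hBℓ)
          push_cast at this ⊢; linear_combination this)
      have h' : (((a₁ * e * R - S : ℤ)) : ZMod 2) = 0 := by push_cast at hcast ⊢; linear_combination hcast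
      exact_mod_cast (ZMod.intCast_zmod_eq_zero_iff_dvd _ 2).mp h'
  · -- `ℓ` odd: `ℓ ∣ (2b + P)² = P² + 4R` and `ℓ ∣ a₁e(2b + P) − 2(a₁be − S) = a₁eP + 2S`
    have hℓD : (ℓ : ℤ) ∣ P ^ 2 + 4 * R := by
      have : P ^ 2 + 4 * R = (2 * b + P) ^ 2 - 4 * (b ^ 2 + P * b - R) := by ring
      rw [this, show b ^ 2 + P * b - R = 0 by rw [hR, hP]; linear_combination hb, mul_zero, sub_zero]
      exact dvd_pow hAℓ two_ne_zero
    have hℓG : (ℓ : ℤ) ∣ a₁ * e * P + 2 * S := by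
      have : a₁ * e * P + 2 * S = a₁ * e * (2 * b + P) - 2 * (a₁ * b * e - S) := by ring
      rw [this]; exact dvd_sub (dvd_mul_of_dvd_right hAℓ _) (dvd_mul_of_dvd_right hBℓ _)
    have hg : (ℓ : ℤ) ∣ (Int.gcd (P ^ 2 + 4 * R) (a₁ * e * P + 2 * S) : ℤ) := Int.dvd_coe_gcd hℓD hℓG
    have hg' : ℓ ∣ Int.gcd (P ^ 2 + 4 * R) (a₁ * e * P + 2 * S) := Int.natCast_dvd_natCast.mp hg
    have h2e : ℓ ∣ (2 * e) ^ n := hg'.trans (by simpa [hP, hR, hS] using hgcd)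
    have h2e' : ℓ ∣ 2 * e := hℓ.dvd_of_dvd_pow h2e
    rcases (Nat.Prime.dvd_mul hℓ).mp h2e' with h | h
    · exact hℓ2 ((Nat.prime_dvd_prime_iff_eq hℓ Nat.prime_two).mp h)
    · exact hℓe h

/-! ### §3 The rung from an existential certificate -/

/-- **The rung of crux `SchneiderAtThree` (item 19106) at a curve carrying a certificate above SOME `y`**, modulo GZK only
(`rung_of_cert`): the `y`-free REG3CERT rows conclude `∃ y, (x, y) ∈ W ∧ ∀ h, CertNonsplit W 3 (x, y) 1`. ONE curve; Schneider
class-wide asserted nowhere; closes nothing by itself. [cite: SteinWuthrich2013, §4.2] [cite: KolyvaginEulerSystems1990, Thm. A] -/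
theorem rung_of_exists_cert (hGZK : rank_eq_analyticRank_of_analyticRank_le_one) (W : WeierstrassCurve ℚ) [W.IsElliptic]
    [W.IsGloballyMinimal] {x : ℚ}
    (hc : ∃ y : ℚ, W.toAffine.Equation x y ∧ ∀ h : W.toAffine.Nonsingular x y, RegMult.CertNonsplit W 3 (.some x y h) 1) :
    ClassX11b W 3 → Ram W 3 → ¬ W.HasSplitMultiplicativeReductionAtPrime 3 →
      ClassClosure.RegulatorNonvanishingAt W 3 := by
  obtain ⟨y, hP, hcert⟩ := hc
  exact rung_of_cert hGZK W hP hcert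

/-- **The Kolyvagin-road twin** (crux `SchneiderTamAtThree`, item 19154) of `rung_of_exists_cert`. ONE curve; nothing class-wide.
[cite: SteinWuthrich2013, §4.2] [cite: KolyvaginEulerSystems1990, Thm. A] -/
theorem rungTam_of_exists_cert (hGZK : rank_eq_analyticRank_of_analyticRank_le_one) (W : WeierstrassCurve ℚ) [W.IsElliptic]
    [W.IsGloballyMinimal] {x : ℚ}
    (hc : ∃ y : ℚ, W.toAffine.Equation x y ∧ ∀ h : W.toAffine.Nonsingular x y, RegMult.CertNonsplit W 3 (.some x y h) 1) :
    ClassX11b W 3 → Ram W 3 → ¬ W.HasSplitMultiplicativeReductionAtPrime 3 → 3 ∣ W.tamagawaProduct →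
      ClassClosure.RegulatorNonvanishingAt W 3 := by
  obtain ⟨y, hP, hcert⟩ := hc
  exact rungTam_of_cert hGZK W hP hcert

/-! ### §4 The equation and admissibility of the pinned point -/

/-- **The point `(a/e², b/e³)` is on `W = ⟨a₁,…,a₆⟩`** when `b² + (a₁ae + a₃e³)b = a³ + a₂a²e² + a₄ae⁴ + a₆e⁶`.
[Silverman AEC III.1] [cite: SilvermanAEC2009, III.1] -/
theorem equation_of_intRoot (W : WeierstrassCurve ℚ) {a₁ a₂ a₃ a₄ a₆ : ℤ} (hW : W = ⟨a₁, a₂, a₃, a₄, a₆⟩) {a b : ℤ} {e : ℕ}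
    (he : e ≠ 0) (hb : b ^ 2 + (a₁ * a * e + a₃ * e ^ 3) * b = a ^ 3 + a₂ * a ^ 2 * e ^ 2 + a₄ * a * e ^ 4 + a₆ * e ^ 6) :
    W.toAffine.Equation ((a : ℚ) / (e : ℚ) ^ 2) ((b : ℚ) / (e : ℚ) ^ 3) := by
  subst hW
  have he' : (e : ℚ) ≠ 0 := by exact_mod_cast he
  have hbQ : ((b : ℚ)) ^ 2 + ((a₁ : ℚ) * a * e + a₃ * (e : ℚ) ^ 3) * b =
      (a : ℚ) ^ 3 + a₂ * (a : ℚ) ^ 2 * (e : ℚ) ^ 2 + a₄ * a * (e : ℚ) ^ 4 + a₆ * (e : ℚ) ^ 6 := by exact_mod_cast hb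
  rw [WeierstrassCurve.Affine.equation_iff]
  field_simp
  linear_combination hbQ

/-- **Admissibility at `3` of the pinned point** `(a/e², b/e³)`, `3 ∣ e`, `gcd(a, e) = 1`, from the `y`-free reduction data
(`isAdmissible_of_one_lt_norm`: AEC VII.3.4 for non-torsion; §2 for non-singular reduction). [cite: SilvermanAEC2009, VII.3.4] -/
theorem isAdmissible_of_yfree (W : WeierstrassCurve ℚ) {a₁ a₂ a₃ a₄ a₆ : ℤ} (hW : W = ⟨a₁, a₂, a₃, a₄, a₆⟩) [W.IsElliptic]
    [W.IsGloballyMinimal] {a b : ℤ} {e n : ℕ} (he : e ≠ 0) (h3e : 3 ∣ e) (hcop : Nat.Coprime a.natAbs e)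
    (hb : b ^ 2 + (a₁ * a * e + a₃ * e ^ 3) * b = a ^ 3 + a₂ * a ^ 2 * e ^ 2 + a₄ * a * e ^ 4 + a₆ * e ^ 6)
    (hgcd : Int.gcd ((a₁ * a * e + a₃ * e ^ 3) ^ 2 + 4 * (a ^ 3 + a₂ * a ^ 2 * e ^ 2 + a₄ * a * e ^ 4 + a₆ * e ^ 6))
      (a₁ * e * (a₁ * a * e + a₃ * e ^ 3) + 2 * (3 * a ^ 2 + 2 * a₂ * a * e ^ 2 + a₄ * e ^ 4)) ∣ (2 * e) ^ n)
    (h2 : ¬ (2 : ℤ) ∣ a₁ * a * e + a₃ * e ^ 3 ∨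
      ¬ (2 : ℤ) ∣ a₁ * e * (a ^ 3 + a₂ * a ^ 2 * e ^ 2 + a₄ * a * e ^ 4 + a₆ * e ^ 6) - (3 * a ^ 2 + 2 * a₂ * a * e ^ 2 + a₄ * e ^ 4))
    {x y : ℚ} (hx : x = a / (e : ℚ) ^ 2) (hy : y = b / (e : ℚ) ^ 3) (h : W.toAffine.Nonsingular x y) :
    W.IsAdmissible 3 (.some x y h) := by
  haveI : Fact (Nat.Prime 3) := ⟨Nat.prime_three⟩
  have hx1 : 1 < ‖(x : ℚ_[3])‖ := (one_lt_norm_ratCast_iff 3 x).mpr (padicValRat_x_neg he hx hcop h3e)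
  exact isAdmissible_of_one_lt_norm (by norm_num) h hx1
    (hasNonsingularReductionAt_of_forall_not_dvd W hW he hx hy hcop (forall_not_dvd_of_yfree hb hgcd h2))

end Summit.BirchSwinnertonDyer.Rank1Residual.X11b.RegMult.KernelCert
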